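import Summits.Ventures.HodgeRepro.Night3WeilModel
import Summits.Ventures.HodgeRepro.Night3WeilModelEigen
import Summits.Ventures.HodgeRepro.Night3WeilModelTensor

/-!
# The lines of a corner product are linearly independent: `dim W_F(B_M) ⊗ ℂ = 2m`

Blind re-derivation cell `pub-hodge-repro`, seat `night-3` (gen 2).  Imports `Night3WeilModel`, `Night3WeilModelEigen` and
`Night3WeilModelTensor`.  Namespace `HodgeRepro.Night3.WeilModel`.

The route reads `W_F(B_M)` as «the ℚ-span of the `2m` eigenlines `ℓ_σ(B_M) = ⊗_i ℓ_σ(H^1(A_{T_i}))`» (ROUTE.md §3.6): a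
`2m`-dimensional space.  In a `WeilModel` the field `hW` only says that the lines SPAN `W a ⊗ L`; this file shows that in
every model whose single factors have linearly independent lines (`hsingle`: the `2m` eigenlines of `H^1(A_T) ⊗ ℂ` are
distinct characters of `F`), the lines of EVERY non-empty multiset are linearly independent — so `W M ⊗ L` has the lines as a
basis and `dim_L (W M ⊗ L) = |ι| = 2m`:

* `linearIndependent_lines_add` — the two-factor step through the Künneth map (`hℓ`, `LinearIndependent.of_comp`; the
  linear algebra `linearIndependent_tmul_of_ne_zero` / `linearIndependent_equiv_comp` from `Night3WeilModelTensor`);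
* `linearIndependent_lines` — the multiset induction; `finrank_baseChange_weil` / `finrank_weil` — the dimension count;
* `linearIndependent_single_of_eigen` — `hsingle` for one factor from its eigen data (the lines are eigenvectors of the
  CM field for pairwise distinct characters, `Night3WeilModelEigen.linearIndependent_of_eigen`), the same data as the
  Rosati input of `Night3WeilModelProduct`.

Nothing here closes S4; no sealed file is touched; no Tier-2 item depends on this file.
-/

set_option autoImplicit false

open TensorProduct

namespace HodgeRepro.Night3.WeilModel

universe u


section Model

variable {K L : Type*} [Field K] [Field L] [Algebra K L] {ι : Type*} {α : Type*}
variable (X : WeilModel.{u} K L ι (Multiset α))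

/-- **The two-factor step**: linearly independent lines on `a` and non-zero lines on `b` give linearly independent lines on
`a + b` — the Künneth map sends `ℓ (a+b) σ` to `ℓ a σ ⊗ ℓ b σ` (`hℓ`), and those are linearly independent. -/
theorem linearIndependent_lines_add {a b : Multiset α} (ha : LinearIndependent L (X.ℓ a))
    (hb : ∀ σ, X.ℓ b σ ≠ 0) : LinearIndependent L (X.ℓ (a + b)) := by
  have h1 : LinearIndependent L fun σ => X.ℓ a σ ⊗ₜ[L] X.ℓ b σ := linearIndependent_tmul_of_ne_zero ha _ hb
  have hℓ' : ∀ σ, (X.κ a b).baseChange L (X.ℓ (a + b) σ) =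
      (AlgebraTensorModule.distribBaseChange K L (X.H a) (X.H b)).symm (X.ℓ a σ ⊗ₜ[L] X.ℓ b σ) := X.hℓ a b
  -- the identification is used as an OPAQUE linear equivalence from here on
  generalize (AlgebraTensorModule.distribBaseChange K L (X.H a) (X.H b)).symm = e at hℓ'
  have h2 : LinearIndependent L (⇑e ∘ fun σ => X.ℓ a σ ⊗ₜ[L] X.ℓ b σ) := linearIndependent_equiv_comp e h1
  refine LinearIndependent.of_comp ((X.κ a b).baseChange L) ?_
  have h3 : (⇑((X.κ a b).baseChange L) ∘ X.ℓ (a + b)) = (⇑e ∘ fun σ => X.ℓ a σ ⊗ₜ[L] X.ℓ b σ) :=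
    funext fun σ => hℓ' σ
  rw [h3]
  exact h2

/-- **The lines of every non-empty corner product are linearly independent**, once those of every single factor are
(`hsingle`: the `2m` eigenlines of `H^1(A_T) ⊗ ℂ`). -/
theorem linearIndependent_lines (hsingle : ∀ T : α, LinearIndependent L (X.ℓ {T})) :
    ∀ M : Multiset α, M ≠ 0 → LinearIndependent L (X.ℓ M) := by
  intro M
  induction M using Multiset.induction_on with
  | empty => intro h; exact absurd rfl h
  | cons T M ih =>
    intro _
    rw [← Multiset.singleton_add]
    by_cases h0 : M = 0
    · subst h0; rw [add_zero]; exact hsingle T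
    · exact X.linearIndependent_lines_add (hsingle T) fun σ => (ih h0).ne_zero σ

/-- **`dim_L (W_F(B_M) ⊗ L) = |ι|`** for every non-empty `M`: the lines are a basis of `W M ⊗ L` (`hW` + linear
independence) — the route's «`2m`-dimensional Weil space» in the kernel. -/
theorem finrank_baseChange_weil [Fintype ι] (hsingle : ∀ T : α, LinearIndependent L (X.ℓ {T}))
    (M : Multiset α) (hM : M ≠ 0) : Module.finrank L ((X.W M).baseChange L) = Fintype.card ι := by
  rw [X.hW]
  exact finrank_span_eq_card (X.linearIndependent_lines hsingle M hM)

/-- **`dim_K W_F(B_M) = |ι|`** for every non-empty `M`: `W M ⊗ L` is the range of the injective map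
`(W M).subtype.baseChange L` (`L` is flat over `K`), whose domain `L ⊗[K] W M` has `L`-dimension `dim_K (W M)`. -/
theorem finrank_weil [Fintype ι] (hsingle : ∀ T : α, LinearIndependent L (X.ℓ {T}))
    (M : Multiset α) (hM : M ≠ 0) : Module.finrank K (X.W M) = Fintype.card ι := by
  have hinj : Function.Injective ((X.W M).subtype.baseChange L) := by
    rw [LinearMap.baseChange_eq_ltensor]
    exact Module.Flat.lTensor_preserves_injective_linearMap _ (X.W M).injective_subtype
  have h1 : Module.finrank L (LinearMap.range ((X.W M).subtype.baseChange L)) =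
      Module.finrank L (L ⊗[K] X.W M) := LinearMap.finrank_range_of_inj hinj
  rw [← X.finrank_baseChange_weil hsingle M hM]
  show Module.finrank K (X.W M) = Module.finrank L (LinearMap.range ((X.W M).subtype.baseChange L))
  rw [h1, Module.finrank_baseChange]

/-- **The single factor's lines are linearly independent from its eigen data**: the lines `ℓ {T} σ` eigenvectors of the
ring `F` (the CM field) acting `L`-linearly on `H {T} ⊗ L`, for pairwise distinct characters `χ σ`, all non-zero — the
`hsingle` of `linearIndependent_lines` / `finrank_weil`. -/
theorem linearIndependent_single_of_eigen {F : Type*} [CommRing F] (T : α) [Module F (L ⊗[K] X.H {T})]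
    [SMulCommClass F L (L ⊗[K] X.H {T})] (χ : ι → (F →+* L)) (hℓ : ∀ i (a : F), a • X.ℓ {T} i = χ i a • X.ℓ {T} i)
    (hχ : Function.Injective χ) (hne : ∀ i, X.ℓ {T} i ≠ 0) : LinearIndependent L (X.ℓ {T}) :=
  linearIndependent_of_eigen (X.ℓ {T}) χ hℓ hχ hne

end Model

end HodgeRepro.Night3.WeilModel
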